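import Literature.NumberTheory.LFunctions.ZetaTruncationUniform
import Literature.NumberTheory.LFunctions.WeilZeroSum
import HarnessLib

/-!
# The partial sums `ζ_M(s) = ∑_{k ≤ M} k^{-s}` at the non-trivial zeros of `ζ`

Topic `Literature/NumberTheory/LFunctions`. Consequences of Titchmarsh's uniform truncation
formula (4.11.1) (`Literature.NumberTheory.LFunctions.norm_zeta_sub_sum_add_le_uniform`) at a
non-trivial zero `ρ = β + iγ` of `ζ` (ANY real part `0 < β < 1`), where `ζ(ρ) = ζ(1-ρ) = 0`
kills the `ζ`-term:

* `Literature.NumberTheory.LFunctions.norm_zetaPartialSum_zero_le` — for `|γ| ≤ 4M`: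
  `|ζ_M(ρ)| ≤ M^{1-β}/|1-ρ| + 6 M^{-β}`;
* `Literature.NumberTheory.LFunctions.norm_zetaPartialSum_mul_le_of_abs_im_le` — for `|γ| ≤ 4M`:
  `|ζ_M(ρ)| |ζ_M(1-ρ)| ≤ M/(|ρ||1-ρ|) + 6/|ρ| + 6/|1-ρ| + 36/M` (uniform in `β`: the powers
  `M^{β}`, `M^{1-β}` of the two factors compensate);
* `Literature.NumberTheory.LFunctions.norm_zetaPartialSum_add_tail_le` — for `M ≤ X`,
  `|γ| ≤ X ≤ 2|γ|`: `|ζ_M(ρ) + ∑_{M<k≤X} k^{-ρ}| ≤ 8 X^{-β}` (the short sum `ζ_M(ρ)` equals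
  minus the complementary sum `∑_{M<k≤X} k^{-ρ}` up to `O(X^{-β})`);
* `Literature.NumberTheory.LFunctions.norm_zetaPartialSum_mul_le_twoSided` — hence
  `|ζ_M(ρ)||ζ_M(1-ρ)| ≤ |R(ρ)| + 8 |Q(ρ)| + 8 |Q̃(ρ)| + 64/X` with the two-sided products
  `R(s) = (∑_{M<k≤X} k^{-s})(∑_{M<l≤X} l^{s-1})`, `Q(s) = (∑_{M<k≤X} k^{-s}) X^{s-1}`,
  `Q̃(s) = X^{-s} ∑_{M<l≤X} l^{s-1}`, whose mean values are bounded uniformly across the strip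
  (`Literature/NumberTheory/LFunctions/DirichletPolynomialStripMeanValue.lean`).

These are the inputs for bounding the zero side of the explicit formula for `ζ`-mollified test
functions (whose Mellin transform carries the factor `ζ_M(1-s)`).

## References

* E. C. Titchmarsh, *The Theory of the Riemann Zeta-Function*, 2nd ed. (1986), Theorem 4.11,
  eq. (4.11.1).
-/

noncomputable section

open Complex Set Finset
open scoped Real ComplexConjugate

namespace Literature.NumberTheory.LFunctions

/-- `1 - ρ` is a non-trivial zero when `ρ` is. [cite: Titchmarsh1986, §2.12] -/
theorem ZetaZeros.riemannZetaNontrivialZeros.one_sub_mem {ρ : ℂ}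
    (h : ρ ∈ ZetaZeros.riemannZetaNontrivialZeros) :
    1 - ρ ∈ ZetaZeros.riemannZetaNontrivialZeros := by
  have h1 := ZetaZeros.riemannZetaNontrivialZeros.conj_mem
    (ZetaZeros.riemannZetaNontrivialZeros.one_sub_conj_mem h)
  simpa using h1

/-- **`ζ_M` at a zero**: for a non-trivial zero `ρ = β + iγ` with `|γ| ≤ 4M` (`M ≥ 1`),
`‖∑_{k=1}^{M} k^{-ρ}‖ ≤ M^{1-β}/‖1-ρ‖ + 6 M^{-β}` (from (4.11.1) and `ζ(ρ) = 0`).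
[cite: Titchmarsh1986, Theorem 4.11, eq. (4.11.1)] -/
theorem norm_zetaPartialSum_zero_le {ρ : ℂ} (hρ : ρ ∈ ZetaZeros.riemannZetaNontrivialZeros)
    {M : ℕ} (hM : 1 ≤ M) (hγ : |ρ.im| ≤ 4 * M) :
    ‖∑ k ∈ Finset.Icc 1 M, (k : ℂ) ^ (-ρ)‖
      ≤ (M : ℝ) ^ (1 - ρ.re) / ‖1 - ρ‖ + 6 * (M : ℝ) ^ (-ρ.re) := by
  have hz := ZetaZeros.riemannZetaNontrivialZeros.zeta_eq_zero hρ
  have h0 := ZetaZeros.riemannZetaNontrivialZeros.re_pos hρ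
  have h1 := ZetaZeros.riemannZetaNontrivialZeros.re_lt_one hρ
  have him := ZetaZeros.riemannZetaNontrivialZeros.im_ne_zero hρ
  have hMpos : (0 : ℝ) < M := by exact_mod_cast hM
  have h := norm_zeta_sub_sum_add_le_uniform h0 (by linarith) him hM hγ
  rw [hz, zero_sub] at h
  have hmain : ‖(M : ℂ) ^ (1 - ρ) / (1 - ρ)‖ = (M : ℝ) ^ (1 - ρ.re) / ‖1 - ρ‖ := by
    rw [norm_div, Complex.norm_natCast_cpow_of_pos (by omega)]
    simp
  calc ‖∑ k ∈ Finset.Icc 1 M, (k : ℂ) ^ (-ρ)‖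
      = ‖(M : ℂ) ^ (1 - ρ) / (1 - ρ)
          - (-∑ k ∈ Finset.Icc 1 M, (k : ℂ) ^ (-ρ) + (M : ℂ) ^ (1 - ρ) / (1 - ρ))‖ := by
        congr 1; ring
    _ ≤ ‖(M : ℂ) ^ (1 - ρ) / (1 - ρ)‖
          + ‖-∑ k ∈ Finset.Icc 1 M, (k : ℂ) ^ (-ρ) + (M : ℂ) ^ (1 - ρ) / (1 - ρ)‖ :=
        norm_sub_le _ _
    _ ≤ (M : ℝ) ^ (1 - ρ.re) / ‖1 - ρ‖ + 6 * (M : ℝ) ^ (-ρ.re) := by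
        rw [hmain]; exact add_le_add le_rfl h

/-- **`ζ_M(ρ) ζ_M(1-ρ)` at a zero, low heights**: for a non-trivial zero `ρ` with `|γ| ≤ 4M`,
`‖∑_{k≤M} k^{-ρ}‖ ‖∑_{k≤M} k^{-(1-ρ)}‖ ≤ M/(‖ρ‖‖1-ρ‖) + 6/‖ρ‖ + 6/‖1-ρ‖ + 36/M`,
uniformly in the real part of `ρ`. [cite: Titchmarsh1986, Theorem 4.11, eq. (4.11.1)] -/
theorem norm_zetaPartialSum_mul_le_of_abs_im_le {ρ : ℂ}
    (hρ : ρ ∈ ZetaZeros.riemannZetaNontrivialZeros) {M : ℕ} (hM : 1 ≤ M)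
    (hγ : |ρ.im| ≤ 4 * M) :
    ‖∑ k ∈ Finset.Icc 1 M, (k : ℂ) ^ (-ρ)‖ * ‖∑ k ∈ Finset.Icc 1 M, (k : ℂ) ^ (-(1 - ρ))‖
      ≤ M / (‖ρ‖ * ‖1 - ρ‖) + 6 / ‖ρ‖ + 6 / ‖1 - ρ‖ + 36 / M := by
  have hρ' := ZetaZeros.riemannZetaNontrivialZeros.one_sub_mem hρ
  have hMpos : (0 : ℝ) < M := by exact_mod_cast hM
  have hne : ρ ≠ 0 := by
    intro h; have := ZetaZeros.riemannZetaNontrivialZeros.re_pos hρ; simp [h] at this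
  have hne1 : 1 - ρ ≠ 0 := by
    intro h; have := ZetaZeros.riemannZetaNontrivialZeros.re_lt_one hρ
    have e : ρ = 1 := by linear_combination -h
    simp [e] at this
  have hn0 : 0 < ‖ρ‖ := norm_pos_iff.2 hne
  have hn1 : 0 < ‖1 - ρ‖ := norm_pos_iff.2 hne1
  have hA := norm_zetaPartialSum_zero_le hρ hM hγ
  have hB := norm_zetaPartialSum_zero_le hρ' hM (by simpa using hγ)
  simp only [sub_sub_cancel, sub_re, one_re] at hB
  have hA0 : 0 ≤ ‖∑ k ∈ Finset.Icc 1 M, (k : ℂ) ^ (-ρ)‖ := norm_nonneg _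
  have hB0 : 0 ≤ ‖∑ k ∈ Finset.Icc 1 M, (k : ℂ) ^ (-(1 - ρ))‖ := norm_nonneg _
  have e1 : (M : ℝ) ^ (1 - ρ.re) * (M : ℝ) ^ ρ.re = M := by
    rw [← Real.rpow_add hMpos]; norm_num
  have e2 : (M : ℝ) ^ (1 - ρ.re) * (M : ℝ) ^ (-(1 - ρ.re)) = 1 := by
    rw [← Real.rpow_add hMpos]; norm_num
  have e3 : (M : ℝ) ^ (-ρ.re) * (M : ℝ) ^ ρ.re = 1 := by
    rw [← Real.rpow_add hMpos]; norm_num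
  have e4 : (M : ℝ) ^ (-ρ.re) * (M : ℝ) ^ (-(1 - ρ.re)) = 1 / M := by
    rw [← Real.rpow_add hMpos, show -ρ.re + -(1 - ρ.re) = (-1 : ℝ) by ring, Real.rpow_neg_one,
      one_div]
  calc ‖∑ k ∈ Finset.Icc 1 M, (k : ℂ) ^ (-ρ)‖ * ‖∑ k ∈ Finset.Icc 1 M, (k : ℂ) ^ (-(1 - ρ))‖
      ≤ ((M : ℝ) ^ (1 - ρ.re) / ‖1 - ρ‖ + 6 * (M : ℝ) ^ (-ρ.re))
          * ((M : ℝ) ^ ρ.re / ‖ρ‖ + 6 * (M : ℝ) ^ (-(1 - ρ.re))) :=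
        mul_le_mul hA hB hB0 (by positivity)
    _ = (M : ℝ) ^ (1 - ρ.re) * (M : ℝ) ^ ρ.re / (‖ρ‖ * ‖1 - ρ‖)
          + 6 * ((M : ℝ) ^ (-ρ.re) * (M : ℝ) ^ ρ.re) / ‖ρ‖
          + 6 * ((M : ℝ) ^ (1 - ρ.re) * (M : ℝ) ^ (-(1 - ρ.re))) / ‖1 - ρ‖
          + 36 * ((M : ℝ) ^ (-ρ.re) * (M : ℝ) ^ (-(1 - ρ.re))) := by
        field_simp
        ring
    _ = M / (‖ρ‖ * ‖1 - ρ‖) + 6 / ‖ρ‖ + 6 / ‖1 - ρ‖ + 36 / M := by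
        rw [e1, e2, e3, e4]; ring

/-! ## Heights above the length: the complementary sum -/

/-- Splitting `∑_{k ≤ X} = ∑_{k ≤ M} + ∑_{M < k ≤ X}` for `M ≤ X`. [folklore] -/
theorem sum_Icc_cpow_eq_add_sum_Ioc {M X : ℕ} (hMX : M ≤ X) (w : ℂ) :
    ∑ k ∈ Finset.Icc 1 X, (k : ℂ) ^ w
      = ∑ k ∈ Finset.Icc 1 M, (k : ℂ) ^ w + ∑ k ∈ Finset.Ioc M X, (k : ℂ) ^ w := by
  have e1 : Finset.Icc 1 X = Finset.Ioc 0 X := by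
    ext n; simp only [Finset.mem_Icc, Finset.mem_Ioc]; omega
  have e2 : Finset.Icc 1 M = Finset.Ioc 0 M := by
    ext n; simp only [Finset.mem_Icc, Finset.mem_Ioc]; omega
  rw [e1, e2, Finset.sum_Ioc_consecutive _ (Nat.zero_le M) hMX]

/-- **The complementary-sum representation at a zero**: for a non-trivial zero `ρ = β + iγ` and
naturals `1 ≤ M ≤ X` with `|γ| ≤ X ≤ 2|γ|`,
`‖∑_{k≤M} k^{-ρ} + ∑_{M<k≤X} k^{-ρ}‖ ≤ 8 X^{-β}`
(`= ζ_X(ρ) = X^{1-ρ}/(1-ρ) + O(X^{-β})` by (4.11.1) and `ζ(ρ) = 0`, and `X^{1-β}/|1-ρ| ≤ 2X^{-β}`).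
[cite: Titchmarsh1986, Theorem 4.11, eq. (4.11.1)] -/
theorem norm_zetaPartialSum_add_tail_le {ρ : ℂ} (hρ : ρ ∈ ZetaZeros.riemannZetaNontrivialZeros)
    {M X : ℕ} (hM : 1 ≤ M) (hMX : M ≤ X) (hγX : |ρ.im| ≤ X) (hXγ : (X : ℝ) ≤ 2 * |ρ.im|) :
    ‖∑ k ∈ Finset.Icc 1 M, (k : ℂ) ^ (-ρ) + ∑ k ∈ Finset.Ioc M X, (k : ℂ) ^ (-ρ)‖
      ≤ 8 * (X : ℝ) ^ (-ρ.re) := by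
  have hX : 1 ≤ X := hM.trans hMX
  have hXpos : (0 : ℝ) < X := by exact_mod_cast hX
  have him := ZetaZeros.riemannZetaNontrivialZeros.im_ne_zero hρ
  have hγpos : 0 < |ρ.im| := abs_pos.2 him
  have h := norm_zetaPartialSum_zero_le hρ hX (by linarith)
  rw [sum_Icc_cpow_eq_add_sum_Ioc hMX] at h
  refine h.trans ?_
  -- `X^{1-β}/‖1-ρ‖ ≤ 2 X^{-β}`
  have h1ρ : |ρ.im| ≤ ‖1 - ρ‖ := by
    have := Complex.abs_im_le_norm (1 - ρ)
    simpa [abs_neg] using this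
  have hkey : (X : ℝ) ^ (1 - ρ.re) / ‖1 - ρ‖ ≤ 2 * (X : ℝ) ^ (-ρ.re) := by
    have hsplit : (X : ℝ) ^ (1 - ρ.re) = X * (X : ℝ) ^ (-ρ.re) := by
      rw [sub_eq_add_neg, Real.rpow_add hXpos, Real.rpow_one]
    rw [hsplit, div_le_iff₀ (hγpos.trans_le h1ρ)]
    have h0 : (0 : ℝ) ≤ (X : ℝ) ^ (-ρ.re) := by positivity
    calc (X : ℝ) * (X : ℝ) ^ (-ρ.re) ≤ (2 * |ρ.im|) * (X : ℝ) ^ (-ρ.re) :=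
          mul_le_mul_of_nonneg_right hXγ h0
      _ ≤ (2 * ‖1 - ρ‖) * (X : ℝ) ^ (-ρ.re) := by gcongr
      _ = 2 * (X : ℝ) ^ (-ρ.re) * ‖1 - ρ‖ := by ring
  linarith

/-- **`ζ_M(ρ) ζ_M(1-ρ)` at a zero above the length, via two-sided products**: for a non-trivial
zero `ρ` and `1 ≤ M ≤ X` with `|γ| ≤ X ≤ 2|γ|`,
`‖ζ_M(ρ)‖ ‖ζ_M(1-ρ)‖ ≤ ‖R(ρ)‖ + 8 ‖Q(ρ)‖ + 8 ‖Q̃(ρ)‖ + 64/X`, where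
`R(s) = (∑_{M<k≤X} k^{-s})(∑_{M<l≤X} l^{s-1})`, `Q(s) = (∑_{M<k≤X} k^{-s})(∑_{l ∈ {X}} l^{s-1})`,
`Q̃(s) = (∑_{k ∈ {X}} k^{-s})(∑_{M<l≤X} l^{s-1})`. [cite: Titchmarsh1986, Theorem 4.11, eq. (4.11.1)] -/
theorem norm_zetaPartialSum_mul_le_twoSided {ρ : ℂ}
    (hρ : ρ ∈ ZetaZeros.riemannZetaNontrivialZeros)
    {M X : ℕ} (hM : 1 ≤ M) (hMX : M ≤ X) (hγX : |ρ.im| ≤ X) (hXγ : (X : ℝ) ≤ 2 * |ρ.im|) :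
    ‖∑ k ∈ Finset.Icc 1 M, (k : ℂ) ^ (-ρ)‖ * ‖∑ k ∈ Finset.Icc 1 M, (k : ℂ) ^ (-(1 - ρ))‖
      ≤ ‖(∑ k ∈ Finset.Ioc M X, (k : ℂ) ^ (-ρ)) * (∑ l ∈ Finset.Ioc M X, (l : ℂ) ^ (ρ - 1))‖
        + 8 * ‖(∑ k ∈ Finset.Ioc M X, (k : ℂ) ^ (-ρ)) * (∑ l ∈ ({X} : Finset ℕ), (l : ℂ) ^ (ρ - 1))‖
        + 8 * ‖(∑ k ∈ ({X} : Finset ℕ), (k : ℂ) ^ (-ρ)) * (∑ l ∈ Finset.Ioc M X, (l : ℂ) ^ (ρ - 1))‖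
        + 64 / X := by
  have hρ' := ZetaZeros.riemannZetaNontrivialZeros.one_sub_mem hρ
  have hX : 1 ≤ X := hM.trans hMX
  have hXpos : (0 : ℝ) < X := by exact_mod_cast hX
  -- the two complementary-sum estimates
  have hA := norm_zetaPartialSum_add_tail_le hρ hM hMX hγX hXγ
  have hB := norm_zetaPartialSum_add_tail_le hρ' hM hMX (by simpa using hγX)
    (by simpa using hXγ)
  simp only [sub_re, one_re] at hB
  -- names
  set Z₁ : ℂ := ∑ k ∈ Finset.Icc 1 M, (k : ℂ) ^ (-ρ) with hZ₁
  set Z₂ : ℂ := ∑ k ∈ Finset.Icc 1 M, (k : ℂ) ^ (-(1 - ρ)) with hZ₂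
  set P₁ : ℂ := ∑ k ∈ Finset.Ioc M X, (k : ℂ) ^ (-ρ) with hP₁
  set P₂ : ℂ := ∑ l ∈ Finset.Ioc M X, (l : ℂ) ^ (ρ - 1) with hP₂
  have hP₂' : ∑ k ∈ Finset.Ioc M X, (k : ℂ) ^ (-(1 - ρ)) = P₂ := by
    simp only [hP₂, neg_sub]
  rw [hP₂'] at hB
  -- `‖Z₁‖ ≤ ‖P₁‖ + 8 X^{-β}`, `‖Z₂‖ ≤ ‖P₂‖ + 8 X^{β-1}`
  have hZ₁le : ‖Z₁‖ ≤ ‖P₁‖ + 8 * (X : ℝ) ^ (-ρ.re) := by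
    calc ‖Z₁‖ = ‖(Z₁ + P₁) - P₁‖ := by ring_nf
      _ ≤ ‖Z₁ + P₁‖ + ‖P₁‖ := norm_sub_le _ _
      _ ≤ _ := by linarith
  have hZ₂le : ‖Z₂‖ ≤ ‖P₂‖ + 8 * (X : ℝ) ^ (-(1 - ρ.re)) := by
    calc ‖Z₂‖ = ‖(Z₂ + P₂) - P₂‖ := by ring_nf
      _ ≤ ‖Z₂ + P₂‖ + ‖P₂‖ := norm_sub_le _ _
      _ ≤ _ := by linarith
  -- the singleton sums and the powers of `X`
  have hsX1 : ∑ l ∈ ({X} : Finset ℕ), (l : ℂ) ^ (ρ - 1) = (X : ℂ) ^ (ρ - 1) := Finset.sum_singleton _ _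
  have hsX2 : ∑ k ∈ ({X} : Finset ℕ), (k : ℂ) ^ (-ρ) = (X : ℂ) ^ (-ρ) := Finset.sum_singleton _ _
  have hnX1 : ‖(X : ℂ) ^ (ρ - 1)‖ = (X : ℝ) ^ (-(1 - ρ.re)) := by
    rw [Complex.norm_natCast_cpow_of_pos (by omega)]; congr 1; simp
  have hnX2 : ‖(X : ℂ) ^ (-ρ)‖ = (X : ℝ) ^ (-ρ.re) := by
    rw [Complex.norm_natCast_cpow_of_pos (by omega)]; simp
  have hXX : (X : ℝ) ^ (-ρ.re) * (X : ℝ) ^ (-(1 - ρ.re)) = 1 / X := by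
    rw [← Real.rpow_add hXpos, show -ρ.re + -(1 - ρ.re) = (-1 : ℝ) by ring, Real.rpow_neg_one,
      one_div]
  rw [hsX1, hsX2, norm_mul, norm_mul, norm_mul, hnX1, hnX2]
  have hP₁0 : 0 ≤ ‖P₁‖ := norm_nonneg _
  have hP₂0 : 0 ≤ ‖P₂‖ := norm_nonneg _
  have hx1 : 0 ≤ (X : ℝ) ^ (-ρ.re) := by positivity
  have hx2 : 0 ≤ (X : ℝ) ^ (-(1 - ρ.re)) := by positivity
  calc ‖Z₁‖ * ‖Z₂‖ ≤ (‖P₁‖ + 8 * (X : ℝ) ^ (-ρ.re)) * (‖P₂‖ + 8 * (X : ℝ) ^ (-(1 - ρ.re))) :=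
        mul_le_mul hZ₁le hZ₂le (norm_nonneg _) (by positivity)
    _ = ‖P₁‖ * ‖P₂‖ + 8 * (‖P₁‖ * (X : ℝ) ^ (-(1 - ρ.re))) + 8 * ((X : ℝ) ^ (-ρ.re) * ‖P₂‖)
        + 64 * ((X : ℝ) ^ (-ρ.re) * (X : ℝ) ^ (-(1 - ρ.re))) := by ring
    _ = ‖P₁‖ * ‖P₂‖ + 8 * (‖P₁‖ * (X : ℝ) ^ (-(1 - ρ.re))) + 8 * ((X : ℝ) ^ (-ρ.re) * ‖P₂‖)
        + 64 / X := by rw [hXX]; ring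

end Literature.NumberTheory.LFunctions
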